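import Summits.CriticalPhenomena.PercolationContinuityZ3.Theorems.PercNearOneGluingNoHeavyLowerTailForestRayleighTwoSumReal
import HarnessLib

/-!
# Weighted forest negative correlation — 2-sums III: `e, f` on different sides of the separation

Notation (`…ForestRayleighTools`, `…TwoSeparation*`, `…TwoSumReal`): `Z(D;K) = Σ_{G ⊆ D, ⟨G ∪ K⟩ acyclic} ∏ w`,
`(R)(D;K;e,f) : Z(D;K∪{e,f})·Z(D;K) ≤ Z(D;K∪e)·Z(D;K∪f)`; sides `D₁,K₁` (edges on `S₁`) and
`D₂,K₂` (edges on `S₂`), `S₁ ∩ S₂ ⊆ {s,t}`, marker `m = st` on neither side.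

For the glued instance `(D₁ ∪ D₂ [∪ m]; K₁ ∪ K₂ [∪ m]; e, f)` the Rayleigh inequality follows from
Rayleigh inequalities of the sides with the marker adjoined (stated exactly as instances of `(R)`
for the sides, so that the 2-sum theorem `…ForestRayleighTwoSum` can feed them), case by case:
`lsm_sep_same` / `lsm_sep_same_free` / `lsm_sep_same_pin` (`e, f` on one side; marker absent /
free / pinned), `lsm_sep_split` / `lsm_sep_split_free` / `lsm_sep_split_pin` (`e`, `f` on
different sides); the case `e = m` is `lsm_sep_marker` in `…TwoSumReal`. [Semple–Welsh, CPC 17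
(2008) §5 Question 2; the 2-sum theorem of Cocks and of Wagner (2008) for matroids — graphic case,
elementary proof via the two-state decomposition `forestsW_sep`] Theorems only; no definitions,
no `sorry`.
-/

open Finset SimpleGraph
open scoped Classical

namespace Summit.CriticalPhenomena.PercolationContinuityZ3.Theorems.ForestRayleigh

variable {V : Type*} [Fintype V] [DecidableEq V]

/-! ### §2 `e, f` on different sides -/

/-- **2-sum, `e` on side 1, `f` on side 2, marker absent.** `(R)(D₁∪D₂; K₁∪K₂; e,f)` from
`(R)(D₁;K₁;e,m)` and `(R)(D₂;K₂;f,m)`: `RHS − LHS` is the product of the two defects.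
[S–W 2008 §5 Q.2, graphic case] -/
theorem lsm_sep_split (w : Sym2 V → ℝ) {D₁ K₁ D₂ K₂ : Finset (Sym2 V)}
    {S₁ S₂ : Set V} {s t : V} (e f : Sym2 V)
    (h₁ : ∀ z ∈ D₁ ∪ insert e K₁, ∀ x ∈ z, x ∈ S₁) (h₂ : ∀ z ∈ D₂ ∪ insert f K₂, ∀ x ∈ z, x ∈ S₂)
    (hS : ∀ x, x ∈ S₁ → x ∈ S₂ → x = s ∨ x = t) (hst : s ≠ t)
    (hL₁ : ∀ z ∈ D₁ ∪ insert e K₁, ¬z.IsDiag) (hL₂ : ∀ z ∈ D₂ ∪ insert f K₂, ¬z.IsDiag)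
    (hm₁ : s(s, t) ∉ D₁ ∪ insert e K₁) (hm₂ : s(s, t) ∉ D₂ ∪ insert f K₂) (hD : Disjoint D₁ D₂)
    (hReRaw : (∑ G ∈ D₁.powerset.filter (fun G =>
        (fromEdgeSet ((G ∪ (insert e (insert s(s, t) K₁)) : Finset (Sym2 V)) : Set (Sym2 V))).IsAcyclic), ∏ x ∈ G, w x) *
      (∑ G ∈ D₁.powerset.filter (fun G =>
        (fromEdgeSet ((G ∪ (K₁) : Finset (Sym2 V)) : Set (Sym2 V))).IsAcyclic), ∏ x ∈ G, w x) ≤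
      (∑ G ∈ D₁.powerset.filter (fun G =>
        (fromEdgeSet ((G ∪ (insert e K₁) : Finset (Sym2 V)) : Set (Sym2 V))).IsAcyclic), ∏ x ∈ G, w x) *
      (∑ G ∈ D₁.powerset.filter (fun G =>
        (fromEdgeSet ((G ∪ (insert s(s, t) K₁) : Finset (Sym2 V)) : Set (Sym2 V))).IsAcyclic), ∏ x ∈ G, w x))
    (hRfRaw : (∑ G ∈ D₂.powerset.filter (fun G =>
        (fromEdgeSet ((G ∪ (insert f (insert s(s, t) K₂)) : Finset (Sym2 V)) : Set (Sym2 V))).IsAcyclic), ∏ x ∈ G, w x) *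
      (∑ G ∈ D₂.powerset.filter (fun G =>
        (fromEdgeSet ((G ∪ (K₂) : Finset (Sym2 V)) : Set (Sym2 V))).IsAcyclic), ∏ x ∈ G, w x) ≤
      (∑ G ∈ D₂.powerset.filter (fun G =>
        (fromEdgeSet ((G ∪ (insert f K₂) : Finset (Sym2 V)) : Set (Sym2 V))).IsAcyclic), ∏ x ∈ G, w x) *
      (∑ G ∈ D₂.powerset.filter (fun G =>
        (fromEdgeSet ((G ∪ (insert s(s, t) K₂) : Finset (Sym2 V)) : Set (Sym2 V))).IsAcyclic), ∏ x ∈ G, w x)) :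
    (∑ G ∈ (D₁ ∪ D₂).powerset.filter (fun G =>
        (fromEdgeSet ((G ∪ (insert e (insert f (K₁ ∪ K₂))) : Finset (Sym2 V)) : Set (Sym2 V))).IsAcyclic), ∏ x ∈ G, w x) *
      (∑ G ∈ (D₁ ∪ D₂).powerset.filter (fun G =>
        (fromEdgeSet ((G ∪ (K₁ ∪ K₂) : Finset (Sym2 V)) : Set (Sym2 V))).IsAcyclic), ∏ x ∈ G, w x) ≤
    (∑ G ∈ (D₁ ∪ D₂).powerset.filter (fun G =>
        (fromEdgeSet ((G ∪ (insert e (K₁ ∪ K₂)) : Finset (Sym2 V)) : Set (Sym2 V))).IsAcyclic), ∏ x ∈ G, w x) *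
      (∑ G ∈ (D₁ ∪ D₂).powerset.filter (fun G =>
        (fromEdgeSet ((G ∪ (insert f (K₁ ∪ K₂)) : Finset (Sym2 V)) : Set (Sym2 V))).IsAcyclic), ∏ x ∈ G, w x) := by
  have hRe := hReRaw
  simp only [Finset.insert_comm e s(s, t) K₁] at hRe
  have hRf := hRfRaw
  simp only [Finset.insert_comm f s(s, t) K₂] at hRf
  have hset₁ : insert e (insert f (K₁ ∪ K₂)) = insert e K₁ ∪ insert f K₂ := by
    rw [Finset.insert_union, Finset.union_insert]
  have hset₂ : insert e (K₁ ∪ K₂) = insert e K₁ ∪ K₂ := by rw [Finset.insert_union]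
  have hset₃ : insert f (K₁ ∪ K₂) = K₁ ∪ insert f K₂ := by rw [Finset.union_insert]
  have s1 : D₁ ∪ K₁ ⊆ D₁ ∪ insert e K₁ :=
    Finset.union_subset_union (subset_refl _) (Finset.subset_insert e K₁)
  have s2 : D₂ ∪ K₂ ⊆ D₂ ∪ insert f K₂ :=
    Finset.union_subset_union (subset_refl _) (Finset.subset_insert f K₂)
  simp only [hset₁]
  simp only [hset₂, hset₃]
  rw [forestsW_sep w h₁ h₂ hS hst hL₁ hL₂
      hm₁ hm₂ hD,
    forestsW_sep w (forall_mem_mono s1 h₁) (forall_mem_mono s2 h₂) hS hst (forall_mem_mono s1 hL₁) (forall_mem_mono s2 hL₂)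
      (fun h => hm₁ (s1 h)) (fun h => hm₂ (s2 h)) hD,
    forestsW_sep w h₁ (forall_mem_mono s2 h₂) hS hst hL₁ (forall_mem_mono s2 hL₂)
      hm₁ (fun h => hm₂ (s2 h)) hD,
    forestsW_sep w (forall_mem_mono s1 h₁) h₂ hS hst (forall_mem_mono s1 hL₁) hL₂
      (fun h => hm₁ (s1 h)) hm₂ hD]
  exact real_sep_split₀ hRe hRf

/-- **2-sum, `e` on side 1, `f` on side 2, marker free.** `(R)(D₁∪D₂∪m; K₁∪K₂; e,f)` from
`(R)(D₁;K₁;e,m)` and `(R)(D₂;K₂;f,m)`. [S–W 2008 §5 Q.2, graphic case] -/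
theorem lsm_sep_split_free (w : Sym2 V → ℝ) {D₁ K₁ D₂ K₂ : Finset (Sym2 V)}
    {S₁ S₂ : Set V} {s t : V} (e f : Sym2 V)
    (h₁ : ∀ z ∈ D₁ ∪ insert e K₁, ∀ x ∈ z, x ∈ S₁) (h₂ : ∀ z ∈ D₂ ∪ insert f K₂, ∀ x ∈ z, x ∈ S₂)
    (hS : ∀ x, x ∈ S₁ → x ∈ S₂ → x = s ∨ x = t) (hst : s ≠ t)
    (hL₁ : ∀ z ∈ D₁ ∪ insert e K₁, ¬z.IsDiag) (hL₂ : ∀ z ∈ D₂ ∪ insert f K₂, ¬z.IsDiag)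
    (hm₁ : s(s, t) ∉ D₁ ∪ insert e K₁) (hm₂ : s(s, t) ∉ D₂ ∪ insert f K₂) (hD : Disjoint D₁ D₂)
    (hReRaw : (∑ G ∈ D₁.powerset.filter (fun G =>
        (fromEdgeSet ((G ∪ (insert e (insert s(s, t) K₁)) : Finset (Sym2 V)) : Set (Sym2 V))).IsAcyclic), ∏ x ∈ G, w x) *
      (∑ G ∈ D₁.powerset.filter (fun G =>
        (fromEdgeSet ((G ∪ (K₁) : Finset (Sym2 V)) : Set (Sym2 V))).IsAcyclic), ∏ x ∈ G, w x) ≤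
      (∑ G ∈ D₁.powerset.filter (fun G =>
        (fromEdgeSet ((G ∪ (insert e K₁) : Finset (Sym2 V)) : Set (Sym2 V))).IsAcyclic), ∏ x ∈ G, w x) *
      (∑ G ∈ D₁.powerset.filter (fun G =>
        (fromEdgeSet ((G ∪ (insert s(s, t) K₁) : Finset (Sym2 V)) : Set (Sym2 V))).IsAcyclic), ∏ x ∈ G, w x))
    (hRfRaw : (∑ G ∈ D₂.powerset.filter (fun G =>
        (fromEdgeSet ((G ∪ (insert f (insert s(s, t) K₂)) : Finset (Sym2 V)) : Set (Sym2 V))).IsAcyclic), ∏ x ∈ G, w x) *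
      (∑ G ∈ D₂.powerset.filter (fun G =>
        (fromEdgeSet ((G ∪ (K₂) : Finset (Sym2 V)) : Set (Sym2 V))).IsAcyclic), ∏ x ∈ G, w x) ≤
      (∑ G ∈ D₂.powerset.filter (fun G =>
        (fromEdgeSet ((G ∪ (insert f K₂) : Finset (Sym2 V)) : Set (Sym2 V))).IsAcyclic), ∏ x ∈ G, w x) *
      (∑ G ∈ D₂.powerset.filter (fun G =>
        (fromEdgeSet ((G ∪ (insert s(s, t) K₂) : Finset (Sym2 V)) : Set (Sym2 V))).IsAcyclic), ∏ x ∈ G, w x)) :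
    (∑ G ∈ (insert s(s, t) (D₁ ∪ D₂)).powerset.filter (fun G =>
        (fromEdgeSet ((G ∪ (insert e (insert f (K₁ ∪ K₂))) : Finset (Sym2 V)) : Set (Sym2 V))).IsAcyclic), ∏ x ∈ G, w x) *
      (∑ G ∈ (insert s(s, t) (D₁ ∪ D₂)).powerset.filter (fun G =>
        (fromEdgeSet ((G ∪ (K₁ ∪ K₂) : Finset (Sym2 V)) : Set (Sym2 V))).IsAcyclic), ∏ x ∈ G, w x) ≤
    (∑ G ∈ (insert s(s, t) (D₁ ∪ D₂)).powerset.filter (fun G =>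
        (fromEdgeSet ((G ∪ (insert e (K₁ ∪ K₂)) : Finset (Sym2 V)) : Set (Sym2 V))).IsAcyclic), ∏ x ∈ G, w x) *
      (∑ G ∈ (insert s(s, t) (D₁ ∪ D₂)).powerset.filter (fun G =>
        (fromEdgeSet ((G ∪ (insert f (K₁ ∪ K₂)) : Finset (Sym2 V)) : Set (Sym2 V))).IsAcyclic), ∏ x ∈ G, w x) := by
  have hRe := hReRaw
  simp only [Finset.insert_comm e s(s, t) K₁] at hRe
  have hRf := hRfRaw
  simp only [Finset.insert_comm f s(s, t) K₂] at hRf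
  have hset₁ : insert e (insert f (K₁ ∪ K₂)) = insert e K₁ ∪ insert f K₂ := by
    rw [Finset.insert_union, Finset.union_insert]
  have hset₂ : insert e (K₁ ∪ K₂) = insert e K₁ ∪ K₂ := by rw [Finset.insert_union]
  have hset₃ : insert f (K₁ ∪ K₂) = K₁ ∪ insert f K₂ := by rw [Finset.union_insert]
  have s1 : D₁ ∪ K₁ ⊆ D₁ ∪ insert e K₁ :=
    Finset.union_subset_union (subset_refl _) (Finset.subset_insert e K₁)
  have s2 : D₂ ∪ K₂ ⊆ D₂ ∪ insert f K₂ :=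
    Finset.union_subset_union (subset_refl _) (Finset.subset_insert f K₂)
  have hmD : s(s, t) ∉ D₁ ∪ D₂ := by
    rw [Finset.mem_union, not_or]
    exact ⟨fun h => hm₁ (Finset.mem_union_left _ h), fun h => hm₂ (Finset.mem_union_left _ h)⟩
  simp only [hset₁]
  simp only [hset₂, hset₃]
  rw [forestsW_insert_split w (D₁ ∪ D₂) (insert e K₁ ∪ insert f K₂) hmD,
    forestsW_insert_split w (D₁ ∪ D₂) (K₁ ∪ K₂) hmD,
    forestsW_insert_split w (D₁ ∪ D₂) (insert e K₁ ∪ K₂) hmD,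
    forestsW_insert_split w (D₁ ∪ D₂) (K₁ ∪ insert f K₂) hmD,
    forestsW_sep w h₁ h₂ hS hst hL₁ hL₂
      hm₁ hm₂ hD,
    forestsW_sep w (forall_mem_mono s1 h₁) (forall_mem_mono s2 h₂) hS hst (forall_mem_mono s1 hL₁) (forall_mem_mono s2 hL₂)
      (fun h => hm₁ (s1 h)) (fun h => hm₂ (s2 h)) hD,
    forestsW_sep w h₁ (forall_mem_mono s2 h₂) hS hst hL₁ (forall_mem_mono s2 hL₂)
      hm₁ (fun h => hm₂ (s2 h)) hD,
    forestsW_sep w (forall_mem_mono s1 h₁) h₂ hS hst (forall_mem_mono s1 hL₁) hL₂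
      (fun h => hm₁ (s1 h)) hm₂ hD,
    forestsW_sep_pin w h₁ h₂ hS hst hL₁ hL₂
      hm₁ hm₂ hD,
    forestsW_sep_pin w (forall_mem_mono s1 h₁) (forall_mem_mono s2 h₂) hS hst (forall_mem_mono s1 hL₁) (forall_mem_mono s2 hL₂)
      (fun h => hm₁ (s1 h)) (fun h => hm₂ (s2 h)) hD,
    forestsW_sep_pin w h₁ (forall_mem_mono s2 h₂) hS hst hL₁ (forall_mem_mono s2 hL₂)
      hm₁ (fun h => hm₂ (s2 h)) hD,
    forestsW_sep_pin w (forall_mem_mono s1 h₁) h₂ hS hst (forall_mem_mono s1 hL₁) hL₂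
      (fun h => hm₁ (s1 h)) hm₂ hD]
  exact real_sep_split hRe hRf

/-- **2-sum, `e` on side 1, `f` on side 2, marker pinned.** Here `(R)` holds with equality:
everything factorises through the pinned marker. [S–W 2008 §5 Q.2, graphic case] -/
theorem lsm_sep_split_pin (w : Sym2 V → ℝ) {D₁ K₁ D₂ K₂ : Finset (Sym2 V)}
    {S₁ S₂ : Set V} {s t : V} (e f : Sym2 V)
    (h₁ : ∀ z ∈ D₁ ∪ insert e K₁, ∀ x ∈ z, x ∈ S₁) (h₂ : ∀ z ∈ D₂ ∪ insert f K₂, ∀ x ∈ z, x ∈ S₂)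
    (hS : ∀ x, x ∈ S₁ → x ∈ S₂ → x = s ∨ x = t) (hst : s ≠ t)
    (hL₁ : ∀ z ∈ D₁ ∪ insert e K₁, ¬z.IsDiag) (hL₂ : ∀ z ∈ D₂ ∪ insert f K₂, ¬z.IsDiag)
    (hm₁ : s(s, t) ∉ D₁ ∪ insert e K₁) (hm₂ : s(s, t) ∉ D₂ ∪ insert f K₂) (hD : Disjoint D₁ D₂) :
    (∑ G ∈ (D₁ ∪ D₂).powerset.filter (fun G =>
        (fromEdgeSet ((G ∪ (insert e (insert f (insert s(s, t) (K₁ ∪ K₂)))) : Finset (Sym2 V)) : Set (Sym2 V))).IsAcyclic), ∏ x ∈ G, w x) *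
      (∑ G ∈ (D₁ ∪ D₂).powerset.filter (fun G =>
        (fromEdgeSet ((G ∪ (insert s(s, t) (K₁ ∪ K₂)) : Finset (Sym2 V)) : Set (Sym2 V))).IsAcyclic), ∏ x ∈ G, w x) ≤
    (∑ G ∈ (D₁ ∪ D₂).powerset.filter (fun G =>
        (fromEdgeSet ((G ∪ (insert e (insert s(s, t) (K₁ ∪ K₂))) : Finset (Sym2 V)) : Set (Sym2 V))).IsAcyclic), ∏ x ∈ G, w x) *
      (∑ G ∈ (D₁ ∪ D₂).powerset.filter (fun G =>
        (fromEdgeSet ((G ∪ (insert f (insert s(s, t) (K₁ ∪ K₂))) : Finset (Sym2 V)) : Set (Sym2 V))).IsAcyclic), ∏ x ∈ G, w x) := by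
  have hset₁ : insert e (insert f (insert s(s, t) (K₁ ∪ K₂))) =
      insert s(s, t) (insert e K₁ ∪ insert f K₂) := by
    ext z; simp only [Finset.mem_insert, Finset.mem_union]; tauto
  have hset₂ : insert e (insert s(s, t) (K₁ ∪ K₂)) = insert s(s, t) (insert e K₁ ∪ K₂) := by
    ext z; simp only [Finset.mem_insert, Finset.mem_union]; tauto
  have hset₃ : insert f (insert s(s, t) (K₁ ∪ K₂)) = insert s(s, t) (K₁ ∪ insert f K₂) := by
    ext z; simp only [Finset.mem_insert, Finset.mem_union]; tauto
  have s1 : D₁ ∪ K₁ ⊆ D₁ ∪ insert e K₁ :=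
    Finset.union_subset_union (subset_refl _) (Finset.subset_insert e K₁)
  have s2 : D₂ ∪ K₂ ⊆ D₂ ∪ insert f K₂ :=
    Finset.union_subset_union (subset_refl _) (Finset.subset_insert f K₂)
  simp only [hset₁]
  simp only [hset₂, hset₃]
  rw [forestsW_sep_pin w h₁ h₂ hS hst hL₁ hL₂
      hm₁ hm₂ hD,
    forestsW_sep_pin w (forall_mem_mono s1 h₁) (forall_mem_mono s2 h₂) hS hst (forall_mem_mono s1 hL₁) (forall_mem_mono s2 hL₂)
      (fun h => hm₁ (s1 h)) (fun h => hm₂ (s2 h)) hD,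
    forestsW_sep_pin w h₁ (forall_mem_mono s2 h₂) hS hst hL₁ (forall_mem_mono s2 hL₂)
      hm₁ (fun h => hm₂ (s2 h)) hD,
    forestsW_sep_pin w (forall_mem_mono s1 h₁) h₂ hS hst (forall_mem_mono s1 hL₁) hL₂
      (fun h => hm₁ (s1 h)) hm₂ hD]
  exact le_of_eq (by ring)

end Summit.CriticalPhenomena.PercolationContinuityZ3.Theorems.ForestRayleigh
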